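import Summits.QuantumFields.BalabanUV.T4Continuum.Support.BalabanAveragedCoerciveFibre

/-!
# T⁴ programme, spine node NE2 (U1a) — UNIFORM COERCIVITY of Bałaban's averaged propagator `Q_k𝒢Q_k^*` at `U = 1`:
# `⟨B, n^d Q_k𝒢Q_kᴴ B⟩ ≥ γ(d,a)·‖B‖²`, `γ(d,a) = ((dπ² + a)(π²/4)^{d+1})⁻¹`, EVERY level `n`, every torus, every `a > 0`

Eighth generation of the NE2 prover lineage P1 of the cell `pub-balaban`, file 12b (the fibre bound is part 12a,
`Support/BalabanAveragedCoerciveFibre`).  `Spine/CoerciveInverseTower` reduced the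
η-rate of the δ-FUNCTION objects of node U1a (`Δ_k` (1.65), `(QGQ*)^{−1}` (1.69)/(3.132)) to ONE typed input: uniform coercivity
of the sandwiched covariance.  THIS FILE PROVES that input for the one-level object of the lineage's leaf `B5QGQ171Unit`
(`covB n hn M a ha = n^d·QvOp 𝒢 QvOpᴴ` on the unit torus `Tor M`, [Balaban1984PropagatorsI] (1.18), (1.71), (1.83)):

 **`coercive_covB`**: `γ(d,a)·Σ|B|² ≤ Re⟨B, covB B⟩` for all `B`, with `gammaB d a = ((dπ² + a)·(π²/4)^{d+1})⁻¹` independent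
 of `n` and `M` — i.e. `CoerciveInverseTower.Coercive (gammaB d a) (covB n hn M a ha)` (**`coercive_covB'`**).

MECHANISM (variational, in momentum space; no inverse is computed).  The lineage's completed square
`B5QGQ171Unit.half_form_effOp_le` says `½⟨B,(a − a²QGQ*)B⟩ ≤ ½n^{−d}⟨A, Δ_aA⟩ − a·Re⟨B, Q_kA⟩ + (a/2)‖B‖²` for EVERY fine field
`A`.  Take the TEST FIELD `A = F_η^* Y` whose fine Fourier coefficients sit on the CENTRAL alias `l = 0` only, with amplitude
`B̂(p′)_μ/(c_Q·u(p′)v_μ(p′))`: by (1.61) (`QvOp_eq`, `What_submatrix_mulVec`) `Q_kA = B` EXACTLY, and `n^{−d}⟨A, Δ_aA⟩ =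
Σ_{p′}⟨y_{p′}, Δ_a(p′) y_{p′}⟩` over the fibres (1.73) with `y_{p′}` supported on `l = 0`, where the fibre form is at most
`(Δ(p′) + a)·|y|² ≤ (dπ² + a)|y|²` (`Δ_a = Δ − ∂P∂* + aQ*Q` with `∂P∂* = (∂P)(∂P)* ⪰ 0`, `|u|, |v_μ| ≤ 1`, `Δ(p′) = Σ_ν|∂_ν(p′)|² ≤ dπ²`)
and `|y_{p′}|² ≤ (π²/4)^{d+1}·n^d·|B̂(p′)|²` by the zone-centre lower bound `|u(p′)v_μ(p′)|² ≥ (4/π²)^{d+1}` (b05's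
`Fiber.cuv_le`, from `B4Strip.Ur_zero_ge`); optimising the scale of `A` gives the claim.  The printed counterpart is the UPPER
half of [B5] (1.67) p. 29 «γ₀⟨∂₁B, ∂₁B⟩ ≦ ⟨B, Δ_kB⟩ ≦ γ₁⟨∂₁B, ∂₁B⟩» («positive constants γ₀, γ₁ dependent on d only»; render
p013 read as an image by this seat) through the dictionary `Δ_k + a = (n^dQ_k𝒢Q_kᴴ)^{−1}` (Woodbury; NOT typed here): our
`γ(d,a)` is a (crude) kernel-certified constant of that type for the `a`-softened object; the transport to the tower
`BalabanAveragedTowerUnit.unitCovB` (index types `Tor (fine 1 M)` vs `Tor M`, semigroup identity) is NOT done here.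

HONEST FRAMING (T4-DAG p. 1).  `U = 1`, FIXED FINITE torus, linear layer; statement and constant OURS ([folklore]); nothing
printed is a hypothesis.  NOT `U ≠ 1`, NOT infinite volume, NOT a mass gap, NOT Clay, NOT summit progress.  HONEST DEPENDENCY:
continuum YM on T⁴ ⇐ BetaPertH ∧ nine spine estimates (0/9 proved); BetaPertH ⇐ (D1) ∧ (D4) ∧ CAP+tail; G-an2-4 gates asym,
D1 and NE2/3/4.  ABSOLUTE RULE kept; no `sorry`.
-/

noncomputable section

open scoped BigOperators ComplexConjugate Matrix ComplexOrder Matrix.Norms.L2Operator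
open Finset Complex

namespace Summit.QuantumFields.BalabanUV.T4Continuum.BalabanAveragedCoercive

open Summit.QuantumFields.BalabanUV.T4Continuum.BalabanAveragedCoerciveFibre

open Literature.MathematicalPhysics.QuantumFieldTheory.Balaban1983to89.B4Strip
open Literature.MathematicalPhysics.QuantumFieldTheory.Balaban1983to89.B5Prop11Leaves
open Literature.MathematicalPhysics.QuantumFieldTheory.Balaban1983to89.B5Prop11Bound
open Literature.MathematicalPhysics.QuantumFieldTheory.Balaban1983to89.B5Prop11Fiber
open Literature.MathematicalPhysics.QuantumFieldTheory.Balaban1983to89.B5Prop11Plancherel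
open Literature.MathematicalPhysics.QuantumFieldTheory.Balaban1983to89.B5Prop11Inverse
open Literature.MathematicalPhysics.QuantumFieldTheory.Balaban1983to89.B5Prop11Lower
open Literature.MathematicalPhysics.QuantumFieldTheory.Balaban1983to89.B5Block118
open Literature.MathematicalPhysics.QuantumFieldTheory.Balaban1983to89.B5QGQ171Unit
open Summit.QuantumFields.BalabanUV.T4Continuum.CoerciveInverseTower (Coercive)

variable {d : ℕ}

/-! ## §3 The test field on the central alias and the coercivity of `Q_k𝒢Q_kᴴ` -/

section Coercivity

variable (n : ℕ) [NeZero n] (hn : 1 ≤ n) (M : Fin d → ℕ) [hM : ∀ μ, NeZero (M μ)] (a : ℝ) (ha : 0 < a)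

/-- the central-alias weight `w(p′)_μ = u(p′)·v_μ(p′)` of (1.61). [cite: Balaban1984PropagatorsI, (1.61) p.28] -/
def wgt (q : Tor M) (μ : Fin d) : ℂ := uSym n (k0 n) (sOf M q) * vSym n (k0 n) (sOf M q) μ

include hn a ha in
/-- the zone-centre lower bound `|u(p′)v_μ(p′)|² ≥ (4/π²)^{d+1}` (b05's `Fiber.cuv_le`; at `p′ = 0` the weight is `1`).
[cite: Balaban1984PropagatorsI, (1.31) p.23, (1.61) p.28] [folklore] -/
theorem norm_wgt_sq_ge (q : Tor M) (μ : Fin d) : (4 / Real.pi ^ 2) ^ (d + 1) ≤ ‖wgt n M q μ‖ ^ 2 := by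
  by_cases hq : q = 0
  · subst hq
    have hu : uSym n (k0 n) (sOf M (0 : Tor M)) = 1 := by
      rw [sOf_zero]; unfold uSym vSym
      refine Finset.prod_eq_one fun μ _ => ?_
      have : dSym n (k0 n) (0 : Fin d → ℝ) μ = 0 := by simp [dSym, shiftr, k0]
      rw [if_pos this]
    have hv : vSym n (k0 n) (sOf M (0 : Tor M)) μ = 1 := by
      rw [sOf_zero]; unfold vSym
      have : dSym n (k0 n) (0 : Fin d → ℝ) μ = 0 := by simp [dSym, shiftr, k0]
      rw [if_pos this]
    rw [wgt, hu, hv, one_mul, norm_one, one_pow]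
    have hπ : (4 : ℝ) / Real.pi ^ 2 ≤ 1 := by
      rw [div_le_one (by positivity)]
      nlinarith [Real.pi_gt_three]
    exact pow_le_one₀ (by positivity) hπ
  · have h := (balabanFiber n hn a ha (sOf M q) (abs_sOf_le M q) (sOf_ne_zero M hq)).cuv_le μ
    exact h

include hn a ha in
/-- the weight is nonzero. [folklore] -/
theorem wgt_ne_zero (q : Tor M) (μ : Fin d) : wgt n M q μ ≠ 0 := by
  intro h
  have h1 := norm_wgt_sq_ge n hn M a ha q μ
  rw [h, norm_zero] at h1
  have h2 : (0 : ℝ) < (4 / Real.pi ^ 2) ^ (d + 1) := by positivity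
  simp at h1
  linarith

/-- the unit-lattice Fourier coefficients of `B`. [folklore] -/
def Bhat (B : Tor M × Fin d → ℂ) : Tor M × Fin d → ℂ := dftV M *ᵥ B

/-- the fibre components of the test field: `c_{p′,μ} = B̂(p′)_μ/(c_Q·w(p′)_μ)`. [folklore] -/
def cq (B : Tor M × Fin d → ℂ) (q : Tor M) : Fin d → ℂ := fun μ => Bhat M B (q, μ) / ((cQ n M : ℂ) * wgt n M q μ)

/-- the test field in coset coordinates: supported on the central alias. [folklore] -/
def Ahat (B : Tor M × Fin d → ℂ) : ((Fin d → Fin n) × Fin d) × Tor M → ℂ := fun I => yC n (cq n M B I.2) I.1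

/-- the test field in fine momentum coordinates. [folklore] -/
def Yf (B : Tor M × Fin d → ℂ) : Tor (fine n M) × Fin d → ℂ := fun P => Ahat n M B (blockEquiv n M P)

/-- **THE TEST FIELD** `A = F_η^* Y`: one fine plane wave per unit-lattice mode, on the central alias, with amplitude
`B̂(p′)_μ/(c_Q u(p′)v_μ(p′))`. [folklore] -/
def Atest (B : Tor M × Fin d → ℂ) : Tor (fine n M) × Fin d → ℂ := star (dftV (fine n M)) *ᵥ Yf n M B

/-- `F_η A = Y`. [folklore] -/
theorem dftV_mulVec_Atest (B : Tor M × Fin d → ℂ) : dftV (fine n M) *ᵥ Atest n M B = Yf n M B := by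
  rw [Atest, Matrix.mulVec_mulVec, dftV_mul_star, Matrix.one_mulVec]

include hn a ha in
/-- **`Q_k A = B` exactly** ((1.61): `Ŵ Y = B̂` since `Y` sits on the central alias with the compensating amplitude).
[cite: Balaban1984PropagatorsI, (1.61) p.28] [folklore] -/
theorem QvOp_mulVec_Atest (B : Tor M × Fin d → ℂ) : QvOp n M *ᵥ Atest n M B = B := by
  have hc : (cQ n M : ℂ) ≠ 0 := by
    rw [cQ_eq]
    have : (0 : ℝ) < (Real.sqrt ((n : ℝ) ^ d))⁻¹ :=
      inv_pos.mpr (Real.sqrt_pos.mpr (pow_pos (by exact_mod_cast Nat.pos_of_ne_zero (NeZero.ne n)) d))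
    exact_mod_cast this.ne'
  have hW : (What n M).submatrix id (blockEquiv n M) *ᵥ Yf n M B = Bhat M B := by
    funext ⟨q, μ⟩
    rw [What_submatrix_mulVec, Finset.sum_eq_single (k0 n)]
    · have hY : Yf n M B (pOf n M (k0 n, q), μ) = cq n M B q μ := by
        rw [Yf, ← emb_eq, show blockEquiv n M (emb n M ((k0 n, μ), q)) = ((k0 n, μ), q) from
          (blockEquiv n M).apply_symm_apply _]
        simp [Ahat, yC]
      rw [hY, cq]
      have hw := wgt_ne_zero n hn M a ha q μ
      rw [show uSym n (k0 n) (sOf M q) * vSym n (k0 n) (sOf M q) μ = wgt n M q μ from rfl]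
      field_simp
    · intro k _ hk
      have hY : Yf n M B (pOf n M (k, q), μ) = 0 := by
        rw [Yf, ← emb_eq, show blockEquiv n M (emb n M ((k, μ), q)) = ((k, μ), q) from
          (blockEquiv n M).apply_symm_apply _]
        simp [Ahat, yC, hk]
      rw [hY, mul_zero]
    · intro h; exact absurd (Finset.mem_univ _) h
  rw [QvOp_eq, ← Matrix.mulVec_mulVec, ← Matrix.mulVec_mulVec, dftV_mulVec_Atest, hW, Bhat, Matrix.mulVec_mulVec,
    star_dftV_mul, Matrix.one_mulVec]

/-- the quadratic form of `Δ_a` on the test field splits over the fibres (1.73). [cite: Balaban1984PropagatorsI, (1.73) p.30]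
[folklore] -/
theorem form_calDa_Atest (B : Tor M × Fin d → ℂ) :
    star (Atest n M B) ⬝ᵥ (calDa n hn M a ha *ᵥ Atest n M B)
      = ∑ q : Tor M, star (yC n (cq n M B q)) ⬝ᵥ (DaBlocks n hn M a ha q *ᵥ yC n (cq n M B q)) := by
  -- through the fine Fourier transform
  have h1 : star (Atest n M B) ⬝ᵥ (calDa n hn M a ha *ᵥ Atest n M B)
      = star (Yf n M B) ⬝ᵥ (calDahat n hn M a ha *ᵥ Yf n M B) := by
    rw [calDa, ← Matrix.mulVec_mulVec, ← Matrix.mulVec_mulVec, dftV_mulVec_Atest, Matrix.star_eq_conjTranspose,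
      star_dotProduct_conjTranspose_mulVec, dftV_mulVec_Atest]
  -- undo the reindexing along `blockEquiv`
  have h2 : star (Yf n M B) ⬝ᵥ (calDahat n hn M a ha *ᵥ Yf n M B)
      = star (Ahat n M B) ⬝ᵥ (Matrix.blockDiagonal (DaBlocks n hn M a ha) *ᵥ Ahat n M B) := by
    rw [calDahat, Matrix.reindex_symm, Matrix.reindex_apply, Equiv.symm_symm]
    have hY : Yf n M B = Ahat n M B ∘ ⇑(blockEquiv n M) := rfl
    have hv : (Ahat n M B ∘ ⇑(blockEquiv n M)) ∘ ⇑(blockEquiv n M).symm = Ahat n M B := by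
      funext I
      simp only [Function.comp_apply, Equiv.apply_symm_apply]
    rw [hY, Matrix.submatrix_mulVec_equiv, hv]
    have hs : star (Ahat n M B ∘ ⇑(blockEquiv n M)) = star (Ahat n M B) ∘ ⇑(blockEquiv n M) := rfl
    rw [hs, dotProduct_comp_equiv]
  -- split the block-diagonal form over the fibres
  have h3 : star (Ahat n M B) ⬝ᵥ (Matrix.blockDiagonal (DaBlocks n hn M a ha) *ᵥ Ahat n M B)
      = ∑ q : Tor M, star (yC n (cq n M B q)) ⬝ᵥ (DaBlocks n hn M a ha q *ᵥ yC n (cq n M B q)) := by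
    simp only [dotProduct, Matrix.mulVec, Pi.star_apply, Ahat]
    rw [Fintype.sum_prod_type, Finset.sum_comm]
    refine Finset.sum_congr rfl fun q _ => Finset.sum_congr rfl fun i _ => ?_
    congr 1
    rw [Fintype.sum_prod_type, Finset.sum_comm, Finset.sum_eq_single q]
    · refine Finset.sum_congr rfl fun j _ => ?_
      rw [Matrix.blockDiagonal_apply_eq]
    · intro q' _ hq'
      refine Finset.sum_eq_zero fun j _ => ?_
      rw [Matrix.blockDiagonal_apply_ne _ _ _ (Ne.symm hq'), zero_mul]
    · intro h; exact absurd (Finset.mem_univ _) h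
  exact h1.trans (h2.trans h3)

/-- `Σ|B̂|² = Σ|B|²` (the unit-lattice DFT is unitary). [folklore] -/
theorem nsq_Bhat (B : Tor M × Fin d → ℂ) : nsq (Bhat M B) = nsq B := by
  have h : star (Bhat M B) ⬝ᵥ Bhat M B = star B ⬝ᵥ B := by
    rw [Bhat, ← star_dotProduct_conjTranspose_mulVec, Matrix.mulVec_mulVec, ← Matrix.star_eq_conjTranspose,
      star_dftV_mul, Matrix.one_mulVec]
  rw [star_dotProduct_self, star_dotProduct_self] at h
  exact_mod_cast h

omit [NeZero n] hM in
/-- the coercivity constant `γ(d,a) = ((dπ² + a)(π²/4)^{d+1})⁻¹` (OURS; crude). [folklore] -/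
def gammaB (d : ℕ) (a : ℝ) : ℝ := ((d * Real.pi ^ 2 + a) * (Real.pi ^ 2 / 4) ^ (d + 1))⁻¹

omit [NeZero n] hM in
include ha in
/-- `0 < γ(d,a)` for `a > 0`. [folklore] -/
theorem gammaB_pos : 0 < gammaB d a := by
  have : 0 < d * Real.pi ^ 2 + a := add_pos_of_nonneg_of_pos (by positivity) ha
  unfold gammaB; positivity

/-- the energy of the test field: `n^{−d}·Re⟨A, Δ_aA⟩ ≤ γ(d,a)⁻¹·Σ|B|²`. [folklore] -/
theorem re_form_calDa_Atest_le (B : Tor M × Fin d → ℂ) :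
    ((n : ℝ) ^ d)⁻¹ * (star (Atest n M B) ⬝ᵥ (calDa n hn M a ha *ᵥ Atest n M B)).re ≤ (gammaB d a)⁻¹ * nsq B := by
  have hnd : (0 : ℝ) < (n : ℝ) ^ d := pow_pos (by exact_mod_cast Nat.pos_of_ne_zero (NeZero.ne n)) d
  have hcQ : (cQ n M) ^ 2 = ((n : ℝ) ^ d)⁻¹ := by rw [cQ_eq, inv_pow, Real.sq_sqrt hnd.le]
  have hK : 0 ≤ d * Real.pi ^ 2 + a := add_nonneg (by positivity) ha.le
  rw [form_calDa_Atest, Complex.re_sum, gammaB, inv_inv]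
  -- fibre by fibre
  have hq : ∀ q, (star (yC n (cq n M B q)) ⬝ᵥ (DaBlocks n hn M a ha q *ᵥ yC n (cq n M B q))).re
      ≤ (d * Real.pi ^ 2 + a) * ((n : ℝ) ^ d * (Real.pi ^ 2 / 4) ^ (d + 1) * ∑ μ, ‖Bhat M B (q, μ)‖ ^ 2) := by
    intro q
    refine (re_form_DaBlocks_yC_le n hn M a ha q _).trans (mul_le_mul_of_nonneg_left ?_ hK)
    unfold nsq cq
    rw [Finset.mul_sum]
    refine Finset.sum_le_sum fun μ _ => ?_
    have hw := norm_wgt_sq_ge n hn M a ha q μ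
    have hw0 : 0 < ‖wgt n M q μ‖ ^ 2 := lt_of_lt_of_le (by positivity) hw
    rw [norm_div, norm_mul, Complex.norm_real, Real.norm_of_nonneg (by rw [cQ_eq]; positivity), div_pow, mul_pow, hcQ]
    rw [div_le_iff₀ (mul_pos (inv_pos.mpr hnd) hw0)]
    have h4 : 1 ≤ (Real.pi ^ 2 / 4) ^ (d + 1) * ‖wgt n M q μ‖ ^ 2 := by
      have e : (Real.pi ^ 2 / 4) ^ (d + 1) * (4 / Real.pi ^ 2) ^ (d + 1) = 1 := by
        rw [← mul_pow]; rw [show Real.pi ^ 2 / 4 * (4 / Real.pi ^ 2) = 1 from by field_simp]; exact one_pow _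
      calc (1 : ℝ) = (Real.pi ^ 2 / 4) ^ (d + 1) * (4 / Real.pi ^ 2) ^ (d + 1) := e.symm
        _ ≤ (Real.pi ^ 2 / 4) ^ (d + 1) * ‖wgt n M q μ‖ ^ 2 := mul_le_mul_of_nonneg_left hw (by positivity)
    have h0 : 0 ≤ ‖Bhat M B (q, μ)‖ ^ 2 := sq_nonneg _
    calc ‖Bhat M B (q, μ)‖ ^ 2 = ‖Bhat M B (q, μ)‖ ^ 2 * 1 := (mul_one _).symm
      _ ≤ ‖Bhat M B (q, μ)‖ ^ 2 * ((Real.pi ^ 2 / 4) ^ (d + 1) * ‖wgt n M q μ‖ ^ 2) :=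
          mul_le_mul_of_nonneg_left h4 h0
      _ = (n : ℝ) ^ d * (Real.pi ^ 2 / 4) ^ (d + 1) * ‖Bhat M B (q, μ)‖ ^ 2 * (((n : ℝ) ^ d)⁻¹ * ‖wgt n M q μ‖ ^ 2) := by
          field_simp
  calc ((n : ℝ) ^ d)⁻¹ * ∑ q, (star (yC n (cq n M B q)) ⬝ᵥ (DaBlocks n hn M a ha q *ᵥ yC n (cq n M B q))).re
      ≤ ((n : ℝ) ^ d)⁻¹ * ∑ q, (d * Real.pi ^ 2 + a) *
          ((n : ℝ) ^ d * (Real.pi ^ 2 / 4) ^ (d + 1) * ∑ μ, ‖Bhat M B (q, μ)‖ ^ 2) :=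
        mul_le_mul_of_nonneg_left (Finset.sum_le_sum fun q _ => hq q) (inv_nonneg.mpr hnd.le)
    _ = (d * Real.pi ^ 2 + a) * (Real.pi ^ 2 / 4) ^ (d + 1) * ∑ q, ∑ μ, ‖Bhat M B (q, μ)‖ ^ 2 := by
        rw [← Finset.mul_sum, ← Finset.mul_sum]; field_simp
    _ = (d * Real.pi ^ 2 + a) * (Real.pi ^ 2 / 4) ^ (d + 1) * nsq B := by
        rw [← nsq_Bhat M B]; unfold nsq; rw [Fintype.sum_prod_type]

/-- **UNIFORM COERCIVITY OF `Q_k𝒢Q_kᴴ` at `U = 1`**: `γ(d,a)·Σ|B|² ≤ Re⟨B, covB B⟩` for every `B`, every level `n`, every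
torus `M`, every `a > 0`, with `γ(d,a) = ((dπ² + a)(π²/4)^{d+1})⁻¹` — the (1.67)-type input of `Spine/CoerciveInverseTower` for the
one-level object of `B5QGQ171Unit`.  Statement and constant OURS. [cite: Balaban1984PropagatorsI, (1.67) p.29 (type), (1.71)
p.30, (1.61) p.28] [folklore] -/
theorem coercive_covB (B : Tor M × Fin d → ℂ) :
    gammaB d a * nsq B ≤ (star B ⬝ᵥ (covB n hn M a ha *ᵥ B)).re := by
  have hγ := gammaB_pos (d := d) a ha
  set K : ℝ := (gammaB d a)⁻¹ with hKdef
  have hK : 0 < K := inv_pos.mpr hγ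
  set R : ℝ := (star B ⬝ᵥ (covB n hn M a ha *ᵥ B)).re with hR
  -- the completed square with the scaled test field `t • A`
  set t : ℝ := a / K with ht
  have hmain := half_form_effOp_le n hn M a ha ((t : ℂ) • Atest n M B) B
  -- evaluate the three terms
  have hE : (star B ⬝ᵥ (effOp n hn M a ha *ᵥ B)).re = a * nsq B - a ^ 2 * R := by
    have e : star B ⬝ᵥ (effOp n hn M a ha *ᵥ B)
        = (a : ℂ) * (star B ⬝ᵥ B) - ((a : ℂ) ^ 2) * (star B ⬝ᵥ (covB n hn M a ha *ᵥ B)) := by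
      unfold effOp
      rw [Matrix.sub_mulVec, Matrix.smul_mulVec, Matrix.smul_mulVec, Matrix.one_mulVec, dotProduct_sub, dotProduct_smul,
        dotProduct_smul, smul_eq_mul, smul_eq_mul]
    rw [e, star_dotProduct_self, Complex.sub_re, Complex.re_ofReal_mul, Complex.ofReal_re, ← Complex.ofReal_pow,
      Complex.re_ofReal_mul]
  have hQ : (star B ⬝ᵥ (QvOp n M *ᵥ ((t : ℂ) • Atest n M B))).re = t * nsq B := by
    rw [Matrix.mulVec_smul, QvOp_mulVec_Atest n hn M a ha, dotProduct_smul, smul_eq_mul, star_dotProduct_self,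
      ← Complex.ofReal_mul, Complex.ofReal_re]
  have hD : (star ((t : ℂ) • Atest n M B) ⬝ᵥ (calDa n hn M a ha *ᵥ ((t : ℂ) • Atest n M B))).re
      = t ^ 2 * (star (Atest n M B) ⬝ᵥ (calDa n hn M a ha *ᵥ Atest n M B)).re := by
    rw [Matrix.mulVec_smul, star_smul, smul_dotProduct, dotProduct_smul, smul_smul, smul_eq_mul, Complex.star_def,
      Complex.conj_ofReal, ← Complex.ofReal_mul, Complex.re_ofReal_mul, pow_two]
  rw [hE, hQ, hD] at hmain
  have hX := re_form_calDa_Atest_le n hn M a ha B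
  rw [← hKdef] at hX
  have hnd : (0 : ℝ) ≤ ((n : ℝ) ^ d)⁻¹ := inv_nonneg.mpr (pow_nonneg (Nat.cast_nonneg _) d)
  -- `hmain`: ½(a‖B‖² − a²R) ≤ ½ n^{-d} t² X − a t ‖B‖² + (a/2)‖B‖²
  have h1 : (1 / 2 : ℝ) * ((n : ℝ) ^ d)⁻¹ * (t ^ 2 * (star (Atest n M B) ⬝ᵥ (calDa n hn M a ha *ᵥ Atest n M B)).re)
      ≤ (1 / 2 : ℝ) * t ^ 2 * (K * nsq B) := by
    have := mul_le_mul_of_nonneg_left hX (show (0 : ℝ) ≤ 1 / 2 * t ^ 2 by positivity)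
    calc (1 / 2 : ℝ) * ((n : ℝ) ^ d)⁻¹ * (t ^ 2 * (star (Atest n M B) ⬝ᵥ (calDa n hn M a ha *ᵥ Atest n M B)).re)
        = 1 / 2 * t ^ 2 * (((n : ℝ) ^ d)⁻¹ * (star (Atest n M B) ⬝ᵥ (calDa n hn M a ha *ᵥ Atest n M B)).re) := by ring
      _ ≤ 1 / 2 * t ^ 2 * (K * nsq B) := this
  have h2 : a ^ 2 * R ≥ 2 * a * t * nsq B - t ^ 2 * K * nsq B := by nlinarith [hmain, h1]
  -- with `t = a/K`: `2at − t²K = a²/K`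
  have h3 : 2 * a * t * nsq B - t ^ 2 * K * nsq B = a ^ 2 * (K⁻¹ * nsq B) := by
    rw [ht]; field_simp; ring
  rw [h3] at h2
  have ha2 : 0 < a ^ 2 := pow_pos ha 2
  have h4 : K⁻¹ * nsq B ≤ R := le_of_mul_le_mul_left (by linarith) ha2
  rwa [hKdef, inv_inv] at h4

/-- the same in the Spine's currency. [folklore] -/
theorem coercive_covB' : Coercive (gammaB d a) (covB n hn M a ha) :=
  fun B => coercive_covB n hn M a ha B

end Coercivity

end Summit.QuantumFields.BalabanUV.T4Continuum.BalabanAveragedCoercive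

end
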